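import Mathlib

/-!
# `Balaban1983to89.B11Eq181Covariance` — [Balaban1985Variational] Sect. G, (181): «U_k(V^v) = U_k(V)^{v̄}» — the gauge
# covariance of the uniquely determined minimal configuration, PROVED in abstract form (invariant functional, equivariant
# constraint sets, unique constrained minimiser ⇒ equivariant minimiser)

statement-level skeleton of published theorems with citation tags; proofs where landed; nothing here is a claim about the Yang–Mills mass gap

CITATION HEADER (lean-in-tree rule 2026-08-18).  T. Bałaban, *The variational problem and background fields in
renormalization group method for lattice gauge theories*, Commun. Math. Phys. **102**, 277–309 (1985),
doi:10.1007/bf01229381 [Balaban1985Variational] (cell paper B11; held `paper:balaban1985-cmp102-variational-background`,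
journal page = PDF page + 276).  p. 307 [PDF 31] quoted from the render-verified transcript
`run/shared/lean/pub/pub-balaban/b2b-balaban-b11/transcript.md` (render `…/1985-cmp102-variational-background-p031-x2.png`);
pp. 278–279 (the spaces (2)–(6), the gauge group (4), Theorem 1) read on the renders p002/p003 by this seat
(lit-balaban reader/typer r08, 2026-08-20).

THE PRINT (p. 307, verbatim).  *«… we obtain a gauge field configuration in the axial gauge, which we denote also by
U_k(V′V₀). It is an analytic function of V′, for V′ with values in a small neighborhood of the identity in Gᶜ, and for
V′ with values in G it coincides with the minimal configuration constructed in the previous sections. This function can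
be extended further using gauge transformations. For the minimal configurations in the axial gauge we have
U_k(V^v) = U_k(V)^{v̄}, (181) where v̄ is constant on blocks B^j(y), y ∈ Λ_j, and equal to v(y). This equality extends
by analyticity to Gᶜ-valued configurations V′ described above …»*  Context (p. 278): the functional (5) and the space
𝔘_k({Ω_j}, ε₀) are gauge invariant; 𝔅_k(𝔅_k, V) is carried to 𝔅_k(𝔅_k, V^v) by u = v̄ (the averages Ū^j are gauge
covariant, [4]); Theorem 1 (p. 279): the minimal orbit is unique, and the axial gauge fixes one representative U_k(V).

WHAT IS PROVED HERE (the G-valued case of (181), abstract form; Mathlib only).  A group `Γ` (gauge transformations v on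
𝔅_k, acting on configurations through v̄ and on data V through V ↦ V^v) acts on a type `X` of configurations and a type
`D` of data; `f : X → ℝ` is `Γ`-invariant (*(5) is gauge invariant*); the admissible sets `S : D → Set X` (the space
(6) ∩ the axial gauge for the datum V) are equivariant, `S (γ • V) = γ • S V`.  Then minimality transports along the
action (`isMinOn_smul_iff`), and a selection `sel V ∈ S V` of minimisers which is UNIQUE in each `S V` (Theorem 1 +
gauge fixing) is equivariant: `sel (γ • V) = γ • sel V` (`minimiser_smul` — the printed (181) with `U_k = sel`,
`γ = v`).  NOT modelled: the analytic continuation to Gᶜ-valued v, V′ (Prop. 9; carrier field `B11.AnData.ExtOrbits`),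
the identification of the block-constant lift v ↦ v̄ and the covariance of the averages ([4] = B7).  Unit
`lit-balaban-r08` (skeleton row B11.Eq181 / r08.85 of `HOME/lit-balaban-r08/ROWS-B11.md`).
-/

namespace Literature.MathematicalPhysics.QuantumFieldTheory.Balaban1983to89.B11Eq181Covariance

open Set
open scoped Pointwise

variable {Γ X D : Type*} [Group Γ] [MulAction Γ X] [MulAction Γ D]

/-- Transport of constrained minimality along the gauge action (pp. 278, 307): for a `Γ`-invariant functional `f` and
equivariant admissible sets `S`, `γ • u` is a minimiser of `f` on `S (γ • V)` iff `u` is one on `S V`.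
[cite: Balaban1985Variational, (181) p.307] -/
theorem isMinOn_smul_iff {f : X → ℝ} (hf : ∀ (γ : Γ) (x : X), f (γ • x) = f x) {S : D → Set X}
    (hS : ∀ (γ : Γ) (V : D), S (γ • V) = γ • S V) (γ : Γ) (V : D) (u : X) :
    IsMinOn f (S (γ • V)) (γ • u) ↔ IsMinOn f (S V) u := by
  rw [hS]
  constructor
  · intro h x hx
    have hx' : γ • x ∈ γ • S V := smul_mem_smul_set hx
    have := h hx'
    simpa [hf] using this
  · intro h x hx
    obtain ⟨y, hy, rfl⟩ := mem_smul_set.1 hx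
    simpa [hf] using h hy

/-- Membership transports as well: `γ • u ∈ S (γ • V) ↔ u ∈ S V`. [cite: Balaban1985Variational, (181) p.307] -/
theorem mem_smul_iff' {S : D → Set X} (hS : ∀ (γ : Γ) (V : D), S (γ • V) = γ • S V) (γ : Γ) (V : D) (u : X) :
    γ • u ∈ S (γ • V) ↔ u ∈ S V := by
  rw [hS, smul_mem_smul_set_iff]

/-- **(181) `U_k(V^v) = U_k(V)^{v̄}`** (G-valued v), abstract form: if `sel V` is a minimiser of the invariant
functional `f` on the equivariant admissible set `S V` and minimisers in each `S V` are UNIQUE (Theorem 1: unique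
minimal orbit, one representative in the axial gauge), then the minimiser map is equivariant, `sel (γ • V) = γ • sel V`.
[cite: Balaban1985Variational, (181) p.307] -/
theorem minimiser_smul {f : X → ℝ} (hf : ∀ (γ : Γ) (x : X), f (γ • x) = f x) {S : D → Set X}
    (hS : ∀ (γ : Γ) (V : D), S (γ • V) = γ • S V) (sel : D → X) (hmem : ∀ V, sel V ∈ S V)
    (hmin : ∀ V, IsMinOn f (S V) (sel V))
    (huniq : ∀ (V : D) (u : X), u ∈ S V → IsMinOn f (S V) u → u = sel V) (γ : Γ) (V : D) :
    sel (γ • V) = γ • sel V := by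
  symm
  refine huniq (γ • V) (γ • sel V) ?_ ?_
  · exact (mem_smul_iff' hS γ V (sel V)).2 (hmem V)
  · exact (isMinOn_smul_iff hf hS γ V (sel V)).2 (hmin V)

/-- The minimum VALUE is gauge invariant: `f (sel (γ • V)) = f (sel V)` (the minimal actions over 𝔅_k(𝔅_k, V) and
𝔅_k(𝔅_k, V^v) agree). [cite: Balaban1985Variational, (181) p.307] -/
theorem min_value_smul {f : X → ℝ} (hf : ∀ (γ : Γ) (x : X), f (γ • x) = f x) {S : D → Set X}
    (hS : ∀ (γ : Γ) (V : D), S (γ • V) = γ • S V) (sel : D → X) (hmem : ∀ V, sel V ∈ S V)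
    (hmin : ∀ V, IsMinOn f (S V) (sel V))
    (huniq : ∀ (V : D) (u : X), u ∈ S V → IsMinOn f (S V) u → u = sel V) (γ : Γ) (V : D) :
    f (sel (γ • V)) = f (sel V) := by
  rw [minimiser_smul hf hS sel hmem hmin huniq γ V, hf]

end Literature.MathematicalPhysics.QuantumFieldTheory.Balaban1983to89.B11Eq181Covariance
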